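import Literature.Probability.Percolation.QuadCrossingRotationCoupling
import Literature.Probability.Percolation.QuadCrossingContinuityOfLemma51
import HarnessLib

/-!
# DKKMO Thm. 1.2 (`d_SS` half, `q = 1`, plane): reduction to couplings agreeing on finitely many quads

Topic `Probability/Percolation`; proofs file next to `QuadCrossingRotationCoupling.lean`, whose one
named fact `dkkmo_theorem_1_2_schrammSmirnov` vendors Duminil-Copin–Kozlowski–Krachun–Manolescu–
Oulamara, *Rotational invariance in critical planar lattice models*, arXiv:2012.11672v1, Theorem 1.2
(Schramm–Smirnov half) at `q = 1`, `Ω = ℝ²`, metric-free: for every `ε > 0` and every open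
neighbourhood `N` of the diagonal of `ℋ_ℂ × ℋ_ℂ` there is `δ₀ > 0` such that for `α ∈ (ε, π - ε)`,
`0 < δ ≤ δ₀` some coupling of two critical bond percolations `ω, ω'` on `ℤ²` puts
`(S_{ω_δ}, e^{iα}·S_{ω'_δ})` outside `N` with probability `< ε`.

**What is proved here** (no definition, no named fact; the fact itself is NOT discharged — its
printed proof rests on DKKMO's universality Theorem 2.3 and the homotopy-topology Theorem 2.2,
§§5–6 of the paper, which the tree does not have):

* `dkkmo_theorem_1_2_schrammSmirnov_of_finiteQuads_of_continuity` — the fact follows from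
  (F) *couplings agreeing on finitely many quads*: for every finite family `F ⊆ 𝒬_ℂ` and `ε > 0`
  there is `δ₀ > 0` such that for `α ∈ (ε, π - ε)`, `0 < δ ≤ δ₀` some coupling of `P_{1/2}` with
  itself has `ℙ[∃ Q ∈ F, 𝟙{Q ∈ S_{ω_δ}} ≠ 𝟙{Q ∈ e^{iα}·S_{ω'_δ}}] < ε`, together with
  (C) Schramm–Smirnov's discrete continuity estimate (5.1) for bond percolation on `δℤ²` (the
  hypothesis of `QuadCrossing.SchrammSmirnov2011_lemma_5_1_of_continuity` at `D = univ`, supplied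
  from the named fact `SchrammSmirnov2011_lemma_5_1` by `Quad.continuity_of_lemma_5_1`);
* `finiteQuads_of_dkkmo_theorem_1_2_schrammSmirnov_of_continuity` — conversely the fact and (C)
  give (F);
* `dkkmo_theorem_1_2_schrammSmirnov_iff_finiteQuads_of_lemma_5_1` — so, granted Schramm–Smirnov's
  Lemma 5.1, DKKMO's configuration-level `d_SS` statement is EQUIVALENT to the statement (F) about
  the crossing indicators of finitely many fixed quads.

This is the step of the printed proof of Theorem 1.2 (§7.1, p. 42) "We use the characterization of
the Schramm–Smirnov distance provided in [GPS]. There exists a family of non-degenerate quads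
`Q_1, …, Q_n` in `Ω` such that if the sets of quads in `Q_1, …, Q_n` that are crossed are the same in
`ω_δ` and `ω'_δ`, then `d_SS(ω_δ, ω'_δ) ≤ ε₀`", made precise: literally the quoted implication is
only true outside an event of small probability (a quad of the family may be crossed in `ω_δ` and
"just not" crossed in `ω'_δ` while the two configurations are close), and that event is controlled
by (5.1) — charged to the UNROTATED configuration, so that no uniformity of the continuity
estimate over rotated quads is needed.

**Proof of `…_of_finiteQuads_of_continuity`.** The sets `int ⊞_Q` and `V^Q = {Q ∉ S}`, `Q ∈ 𝒬_ℂ`,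
form a subbase of Schramm–Smirnov's topology `𝒯` (`QuadConfig.exists_finite_pieces_nhds`: a
subbasic `V_U ∋ S₀`, `U` open, contains `int ⊞_{Q⁻} ∋ S₀` for a quad `Q⁻ ∈ U` below a quad of
`S₀ ∩ U`, by `(esb)` and `QuadConfig.mem_interior_crossedEvent_of_mem`).  By compactness of `ℋ_ℂ`
(`QuadConfig.compactSpace`) an open neighbourhood `N` of the diagonal yields finitely many such
pieces `s` with: `(S, S') ∉ N ⟹ S ∈ s ∌ S'` for one of them
(`QuadConfig.exists_finite_pieces_of_nhds_diagonal`).  For `s = V^Q` this is a disagreement of the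
crossing indicators of `Q`; for `s = int ⊞_Q`, with `Q' < Q < Q⁺ < Q''` from (5.1) at `Q` (chosen
AFTER the pieces, with budget `ε / (2(n+1))` each), either the indicators of `Q⁺` disagree or `ω`
lies in the (5.1)-event `{Q' raw-crossed ∧ Q'' not}` (`S' ∉ int ⊞_Q ⟹ Q⁺ ∉ S'`; `Q ∈ S_ω ⟹ Q'`
raw-crossed, `Quad.exists_isCrossing_of_mem_closure`; `Q⁺ ∉ S_ω ⟹ Q''` not raw-crossed).  A union
bound under the coupling of (F) for the finite family `{Q⁺} ∪ {Q}` at `ε/2` concludes.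
**Converse.** For `Q ∈ F` take `Q' < Q_m < Q < Q_p < Q''` from (5.1) and the open neighbourhood
`N = ⋂_{Q ∈ F} {Q_p ∈ S ⟹ S' ∈ int ⊞_Q} ∩ {Q ∈ S' ⟹ S ∈ int ⊞_{Q_m}}` of the diagonal; on `N` a
disagreement at `Q` forces `ω` into the (5.1)-event of `Q`.

## References

* [DKKMO2020Rotational] H. Duminil-Copin, K. K. Kozlowski, D. Krachun, I. Manolescu, M. Oulamara,
  arXiv:2012.11672v1 (2020): Thm. 1.2 p. 5; §7.1 p. 42 (the `[GPS]` characterization step).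
* [SchrammSmirnov2011] O. Schramm, S. Smirnov, Ann. Probab. 39 (2011), arXiv:1101.5820: §1.3
  (`ℋ_D`, `𝒯_D`), Thm. 1.4, Lemma 5.1 and eq. (5.1).
-/

noncomputable section

open Set Filter
open _root_.MeasureTheory _root_.Topology
open scoped ENNReal
open Literature.Probability.LatticeModels

namespace Literature.Probability.Percolation

namespace QuadCrossing

namespace QuadConfig

/-! ### The subbase `int ⊞_Q`, `V^Q` of Schramm–Smirnov's topology and finite detecting families -/

/-- A subbasic open set `V_U ∋ S` (`U ⊆ 𝒬_ℂ` open) contains a set `int ⊞_Q ∋ S` with `Q ∈ U`: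
for `Q₁ ∈ S ∩ U` pick `Q ∈ U` with `Q < Q₁` (`(esb)`, `Quad.mem_closure_setOf_strictlyDominated`);
then `S ∈ int ⊞_Q` (`mem_interior_crossedEvent_of_mem`) and `int ⊞_Q ⊆ ⊞_Q ⊆ V_U`.
[cite: SchrammSmirnov2011, §1.3 and §3 (esb)] -/
theorem exists_interior_crossedEvent_subset_someCrossed {U : Set (Quad (univ : Set ℂ))}
    (hU : IsOpen U) {S : QuadConfig (univ : Set ℂ)} (hS : S ∈ someCrossed U) :
    ∃ Q ∈ U, S ∈ interior (crossedEvent Q) ∧ interior (crossedEvent Q) ⊆ someCrossed U := by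
  obtain ⟨Q₁, hQ₁S, hQ₁U⟩ := hS
  obtain ⟨Q, hQU, hQQ₁⟩ := mem_closure_iff.mp
    (Quad.mem_closure_setOf_strictlyDominated isOpen_univ Q₁) U hU hQ₁U
  refine ⟨Q, hQU, mem_interior_crossedEvent_of_mem hQQ₁ hQ₁S, fun T hT => ?_⟩
  have hQT : T ∈ crossedEvent Q := interior_subset hT
  exact ⟨Q, hQT, hQU⟩

/-- **The sets `int ⊞_Q` and `V^Q` form a subbase of `𝒯`**, in the form used below: every
neighbourhood `O` of `S₀ ∈ ℋ_ℂ` contains a finite intersection of such sets containing `S₀`.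
[cite: SchrammSmirnov2011, §1.3] -/
theorem exists_finite_pieces_nhds (S₀ : QuadConfig (univ : Set ℂ))
    {O : Set (QuadConfig (univ : Set ℂ))} (hO : O ∈ 𝓝 S₀) :
    ∃ f : Set (Set (QuadConfig (univ : Set ℂ))), f.Finite ∧
      (∀ s ∈ f, (∃ Q, s = interior (crossedEvent Q)) ∨ ∃ Q, s = notCrossed Q) ∧
      S₀ ∈ ⋂₀ f ∧ ⋂₀ f ⊆ O := by
  have hbasis := TopologicalSpace.isTopologicalBasis_of_subbasis
    (t := (instTopologicalSpace : TopologicalSpace (QuadConfig (univ : Set ℂ))))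
    (s := {V | ∃ U : Set (Quad (univ : Set ℂ)), IsOpen U ∧ V = someCrossed U} ∪
      {V | ∃ Q : Quad (univ : Set ℂ), V = notCrossed Q}) rfl
  obtain ⟨_, ⟨g, ⟨hgfin, hgsub⟩, rfl⟩, hS₀, hgO⟩ := hbasis.mem_nhds_iff.mp hO
  have key : ∀ s ∈ g, ∃ p : Set (QuadConfig (univ : Set ℂ)),
      ((∃ Q, p = interior (crossedEvent Q)) ∨ ∃ Q, p = notCrossed Q) ∧ S₀ ∈ p ∧ p ⊆ s := by
    intro s hs
    rcases hgsub hs with ⟨U, hU, rfl⟩ | ⟨Q, rfl⟩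
    · obtain ⟨Q, -, hSQ, hsub⟩ :=
        exists_interior_crossedEvent_subset_someCrossed hU (mem_sInter.mp hS₀ _ hs)
      exact ⟨_, Or.inl ⟨Q, rfl⟩, hSQ, hsub⟩
    · exact ⟨_, Or.inr ⟨Q, rfl⟩, mem_sInter.mp hS₀ _ hs, Subset.rfl⟩
  choose! p hp using key
  refine ⟨p '' g, hgfin.image p, ?_, ?_, ?_⟩
  · rintro _ ⟨s, hs, rfl⟩
    exact (hp s hs).1
  · refine mem_sInter.mpr ?_
    rintro _ ⟨s, hs, rfl⟩
    exact (hp s hs).2.1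
  · intro S hS
    exact hgO (mem_sInter.mpr fun s hs => (hp s hs).2.2 (mem_sInter.mp hS _ (mem_image_of_mem p hs)))

/-- **Finitely many pieces detect an open neighbourhood of the diagonal.**  For `N` open
containing the diagonal of the compact space `ℋ_ℂ × ℋ_ℂ` (`compactSpace`, Schramm–Smirnov Thm. 1.4)
there are finitely many sets `s`, each of the form `int ⊞_Q` or `V^Q`, such that whenever
`(S, S') ∉ N` one of them contains `S` but not `S'` (cover `ℋ_ℂ` by finitely many basic open sets
`B` with `B × B ⊆ N`). [cite: SchrammSmirnov2011, Thm. 1.4 (1)] -/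
theorem exists_finite_pieces_of_nhds_diagonal
    {N : Set (QuadConfig (univ : Set ℂ) × QuadConfig (univ : Set ℂ))} (hN : IsOpen N)
    (hdiag : ∀ S, (S, S) ∈ N) :
    ∃ 𝔉 : Set (Set (QuadConfig (univ : Set ℂ))), 𝔉.Finite ∧
      (∀ s ∈ 𝔉, (∃ Q, s = interior (crossedEvent Q)) ∨ ∃ Q, s = notCrossed Q) ∧
      ∀ S S' : QuadConfig (univ : Set ℂ), (S, S') ∉ N → ∃ s ∈ 𝔉, S ∈ s ∧ S' ∉ s := by
  haveI : CompactSpace (QuadConfig (univ : Set ℂ)) := compactSpace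
  have key : ∀ S₀ : QuadConfig (univ : Set ℂ), ∃ f : Set (Set (QuadConfig (univ : Set ℂ))),
      f.Finite ∧ (∀ s ∈ f, (∃ Q, s = interior (crossedEvent Q)) ∨ ∃ Q, s = notCrossed Q) ∧
      S₀ ∈ ⋂₀ f ∧ ∀ S ∈ ⋂₀ f, ∀ S' ∈ ⋂₀ f, (S, S') ∈ N := by
    intro S₀
    obtain ⟨V, W, hV, hW, hSV, hSW, hVW⟩ := isOpen_prod_iff.mp hN S₀ S₀ (hdiag S₀)
    obtain ⟨f, hf, hpieces, hS₀, hfO⟩ :=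
      exists_finite_pieces_nhds S₀ ((hV.inter hW).mem_nhds ⟨hSV, hSW⟩)
    exact ⟨f, hf, hpieces, hS₀, fun S hS S' hS' => hVW ⟨(hfO hS).1, (hfO hS').2⟩⟩
  choose f hf hpieces hS₀f hfN using key
  have hopen : ∀ S₀, IsOpen (⋂₀ f S₀) := fun S₀ => (hf S₀).isOpen_sInter fun s hs => by
    rcases hpieces S₀ s hs with ⟨Q, rfl⟩ | ⟨Q, rfl⟩
    · exact isOpen_interior
    · exact isOpen_notCrossed Q
  obtain ⟨T, hT⟩ := isCompact_univ.elim_finite_subcover (fun S₀ => ⋂₀ f S₀) hopen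
    fun S _ => mem_iUnion.2 ⟨S, hS₀f S⟩
  refine ⟨⋃ S₀ ∈ (T : Set (QuadConfig (univ : Set ℂ))), f S₀,
    T.finite_toSet.biUnion fun S₀ _ => hf S₀, ?_, ?_⟩
  · intro s hs
    obtain ⟨S₀, -, hs⟩ := mem_iUnion₂.mp hs
    exact hpieces S₀ s hs
  · intro S S' hSS'
    obtain ⟨S₀, hS₀T, hS⟩ := mem_iUnion₂.mp (hT (mem_univ S))
    by_contra hcon
    refine hSS' (hfN S₀ S hS S' (mem_sInter.mpr fun s hs => ?_))
    by_contra hS's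
    exact hcon ⟨s, mem_iUnion₂.mpr ⟨S₀, hS₀T, hs⟩, mem_sInter.mp hS s hs, hS's⟩

end QuadConfig

end QuadCrossing

open QuadCrossing

/-! ### Raw crossings from membership in `S_ω`; arithmetic of the budgets -/

/-- `P₂ ∈ S_ω` and `P₁ < P₂` give a crossing of `P₁` inside the drawn open edges (`S_ω` is the
closure of the raw crossed quads, `Quad.exists_isCrossing_of_mem_closure`). [cite: SchrammSmirnov2011, §1.3] -/
theorem exists_isCrossing_of_mem_z2QuadConfig {δ : ℝ} {ω : BondConfig (Site 2)}
    {P₁ P₂ : Quad (univ : Set ℂ)} (h : Quad.StrictlyDominated P₁ P₂)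
    (hmem : P₂ ∈ z2QuadConfig univ δ ω) : ∃ K, P₁.IsCrossing K ∧ K ⊆ openEdgeUnion δ ω := by
  have hmem' : P₂ ∈ (z2QuadConfig univ δ ω : Set (Quad (univ : Set ℂ))) := hmem
  rw [coe_z2QuadConfig] at hmem'
  exact Quad.exists_isCrossing_of_mem_closure h hmem'

/-- `P₁ ∉ S_ω` and `P₁ < P₂` forbid a crossing of `P₂` inside the drawn open edges (a raw
crossed quad lies in the lower set `S_ω`). [cite: SchrammSmirnov2011, §1.3] -/
theorem not_exists_isCrossing_of_not_mem_z2QuadConfig {δ : ℝ} {ω : BondConfig (Site 2)}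
    {P₁ P₂ : Quad (univ : Set ℂ)} (h : Quad.StrictlyDominated P₁ P₂)
    (hP₁ : P₁ ∉ z2QuadConfig univ δ ω) : ¬ ∃ K, P₂.IsCrossing K ∧ K ⊆ openEdgeUnion δ ω := by
  rintro ⟨K, hK, hKO⟩
  exact hP₁ ((z2QuadConfig univ δ ω).isLowerQuadSet (mem_z2QuadConfig_of_isCrossing hK hKO) h)

/-- Budget arithmetic: `n · ε / (2(n+1)) ≤ ε / 2` in `ℝ≥0∞`. [folklore] -/
theorem natCast_mul_ofReal_div_le (n : ℕ) {ε : ℝ} (hε : 0 ≤ ε) :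
    (n : ℝ≥0∞) * ENNReal.ofReal (ε / (2 * (n + 1))) ≤ ENNReal.ofReal (ε / 2) := by
  rw [← ENNReal.ofReal_natCast, ← ENNReal.ofReal_mul (Nat.cast_nonneg n)]
  refine ENNReal.ofReal_le_ofReal ?_
  rw [← mul_div_assoc, div_le_iff₀ (by positivity)]
  nlinarith [mul_nonneg (Nat.cast_nonneg (α := ℝ) n) hε]

/-- A positive lower bound for finitely many positive reals. [folklore] -/
theorem exists_pos_le_of_finite {ι : Type*} {s : Set ι} (hs : s.Finite) {f : ι → ℝ}
    (hf : ∀ i ∈ s, 0 < f i) : ∃ δ : ℝ, 0 < δ ∧ ∀ i ∈ s, δ ≤ f i := by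
  classical
  rcases hs.toFinset.eq_empty_or_nonempty with h0 | hne
  · refine ⟨1, one_pos, fun i hi => ?_⟩
    have : i ∈ hs.toFinset := hs.mem_toFinset.2 hi
    rw [h0] at this
    exact absurd this (Finset.notMem_empty i)
  · obtain ⟨i₀, hi₀, hmin⟩ := hs.toFinset.exists_min_image f hne
    exact ⟨f i₀, hf i₀ (hs.mem_toFinset.1 hi₀), fun i hi => hmin i (hs.mem_toFinset.2 hi)⟩

/-! ### Per-piece estimate -/

/-- **What a piece costs.**  Given the continuity estimate (5.1) and a piece `s` (`int ⊞_Q` or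
`V^Q`), for every budget `η > 0` there are a quad `q`, events `E_δ` of `P_{1/2}`-probability
`≤ η` for small meshes, such that: if `S_{ω_δ} ∈ s` and `S' ∉ s` then either `ω ∈ E_δ` or the
crossing indicators of `q` in `S_{ω_δ}` and `S'` disagree.  For `V^Q`: `q = Q`, `E = ∅`.  For
`int ⊞_Q`: `Q' < Q < Q⁺ < Q''` from (5.1), `q = Q⁺`, `E_δ = {Q' raw-crossed ∧ Q'' not}`.
[cite: SchrammSmirnov2011, eq. (5.1); DKKMO2020Rotational, §7.1 p. 42] -/
theorem exists_quad_event_of_piece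
    (hcont : ∀ (Q₀ : Quad (univ : Set ℂ)) (ε : ℝ≥0∞), 0 < ε →
      ∃ Q' Q'' : Quad (univ : Set ℂ), Quad.StrictlyDominated Q' Q₀ ∧ Quad.StrictlyDominated Q₀ Q'' ∧
        ∃ δ₀ : ℝ, 0 < δ₀ ∧ ∀ δ : ℝ, 0 < δ → δ < δ₀ →
          bondPercolation (zdGraph 2) half
            {ω | (∃ K, Q'.IsCrossing K ∧ K ⊆ openEdgeUnion δ ω) ∧
              ¬ ∃ K, Q''.IsCrossing K ∧ K ⊆ openEdgeUnion δ ω} ≤ ε)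
    {s : Set (QuadConfig (univ : Set ℂ))}
    (hs : (∃ Q, s = interior (QuadConfig.crossedEvent Q)) ∨ ∃ Q, s = QuadConfig.notCrossed Q)
    {η : ℝ≥0∞} (hη : 0 < η) :
    ∃ (q : Quad (univ : Set ℂ)) (E : ℝ → Set (BondConfig (Site 2))) (δ₁ : ℝ), 0 < δ₁ ∧
      (∀ δ : ℝ, 0 < δ → δ < δ₁ → bondPercolation (zdGraph 2) half (E δ) ≤ η) ∧
      ∀ (δ : ℝ) (ω : BondConfig (Site 2)) (S' : QuadConfig (univ : Set ℂ)),
        z2QuadConfig univ δ ω ∈ s → S' ∉ s →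
          ω ∈ E δ ∨ ¬ (q ∈ z2QuadConfig univ δ ω ↔ q ∈ S') := by
  rcases hs with ⟨Q, rfl⟩ | ⟨Q, rfl⟩
  · obtain ⟨Q', Q'', hQ'Q, hQQ'', δ₁, hδ₁, hE⟩ := hcont Q η hη
    obtain ⟨Qp, hQQp, hQpQ''⟩ := Quad.exists_strictlyDominated_between isOpen_univ hQQ''
    refine ⟨Qp, fun δ => {ω | (∃ K, Q'.IsCrossing K ∧ K ⊆ openEdgeUnion δ ω) ∧
      ¬ ∃ K, Q''.IsCrossing K ∧ K ⊆ openEdgeUnion δ ω}, δ₁, hδ₁, hE, fun δ ω S' hS hS' => ?_⟩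
    have hQS : z2QuadConfig univ δ ω ∈ QuadConfig.crossedEvent Q := interior_subset hS
    have hQpS' : Qp ∉ S' := fun h' => hS' (QuadConfig.mem_interior_crossedEvent_of_mem hQQp h')
    by_cases hq : Qp ∈ z2QuadConfig univ δ ω
    · exact Or.inr fun hiff => hQpS' (hiff.mp hq)
    · exact Or.inl ⟨exists_isCrossing_of_mem_z2QuadConfig hQ'Q hQS,
        not_exists_isCrossing_of_not_mem_z2QuadConfig hQpQ'' hq⟩
  · refine ⟨Q, fun _ => ∅, 1, one_pos, fun δ _ _ => by simp, fun δ ω S' hS hS' => Or.inr ?_⟩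
    have hQS' : Q ∈ S' := not_not.mp hS'
    exact fun hiff => hS (hiff.mpr hQS')

/-! ### The fact from couplings agreeing on finitely many quads -/

/-- **DKKMO Thm. 1.2 (`d_SS` half, `q = 1`, plane) from couplings agreeing on finitely many
quads and the continuity estimate (5.1).**  Hypotheses: `hcont` — Schramm–Smirnov's (5.1) for
critical bond percolation on `δℤ²` (literally the hypothesis of
`QuadCrossing.SchrammSmirnov2011_lemma_5_1_of_continuity` at `D = univ`); `hF` — for every
`ε > 0` and every finite family `F` of quads there is `δ₀ > 0` such that for `α ∈ (ε, π - ε)` and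
`0 < δ ≤ δ₀` some coupling of `P_{1/2}` with itself makes the crossing indicators of every
`Q ∈ F` in `S_{ω_δ}` and in `e^{iα}·S_{ω'_δ}` agree outside an event of probability `< ε`.
Conclusion: `dkkmo_theorem_1_2_schrammSmirnov`.  (The `[GPS]`-characterization step of the
printed proof, §7.1 p. 42, in probabilistic form; see the module docstring for the proof.)
[cite: DKKMO2020Rotational, Thm. 1.2 (d_SS part) and §7.1 p. 42] -/
theorem dkkmo_theorem_1_2_schrammSmirnov_of_finiteQuads_of_continuity
    (hcont : ∀ (Q₀ : Quad (univ : Set ℂ)) (ε : ℝ≥0∞), 0 < ε →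
      ∃ Q' Q'' : Quad (univ : Set ℂ), Quad.StrictlyDominated Q' Q₀ ∧ Quad.StrictlyDominated Q₀ Q'' ∧
        ∃ δ₀ : ℝ, 0 < δ₀ ∧ ∀ δ : ℝ, 0 < δ → δ < δ₀ →
          bondPercolation (zdGraph 2) half
            {ω | (∃ K, Q'.IsCrossing K ∧ K ⊆ openEdgeUnion δ ω) ∧
              ¬ ∃ K, Q''.IsCrossing K ∧ K ⊆ openEdgeUnion δ ω} ≤ ε)
    (hF : ∀ ε : ℝ, 0 < ε → ∀ F : Finset (Quad (univ : Set ℂ)),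
      ∃ δ₀ : ℝ, 0 < δ₀ ∧ ∀ α ∈ Set.Ioo ε (Real.pi - ε), ∀ δ : ℝ, 0 < δ → δ ≤ δ₀ →
        ∃ P : Measure (BondConfig (Site 2) × BondConfig (Site 2)),
          P.map Prod.fst = bondPercolation (zdGraph 2) half ∧
          P.map Prod.snd = bondPercolation (zdGraph 2) half ∧
          P {p | ∃ Q ∈ F, ¬ (Q ∈ z2QuadConfig univ δ p.1 ↔
            Q ∈ QuadConfig.rotate α (z2QuadConfig univ δ p.2))} < ENNReal.ofReal ε) :
    dkkmo_theorem_1_2_schrammSmirnov := by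
  classical
  intro ε hε N hN hdiag
  obtain ⟨𝔉, h𝔉, hpieces, hdetect⟩ := QuadConfig.exists_finite_pieces_of_nhds_diagonal hN hdiag
  -- the budget of each piece
  set n : ℕ := h𝔉.toFinset.card with hn
  have hηpos : 0 < ε / (2 * (n + 1)) := by positivity
  have hη0 : 0 < ENNReal.ofReal (ε / (2 * (n + 1))) := ENNReal.ofReal_pos.2 hηpos
  -- per-piece data: a quad, a family of small events, a mesh bound
  have key : ∀ s ∈ 𝔉, ∃ (q : Quad (univ : Set ℂ)) (E : ℝ → Set (BondConfig (Site 2))) (δ₁ : ℝ),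
      0 < δ₁ ∧
      (∀ δ : ℝ, 0 < δ → δ < δ₁ →
        bondPercolation (zdGraph 2) half (E δ) ≤ ENNReal.ofReal (ε / (2 * (n + 1)))) ∧
      ∀ (δ : ℝ) (ω : BondConfig (Site 2)) (S' : QuadConfig (univ : Set ℂ)),
        z2QuadConfig univ δ ω ∈ s → S' ∉ s → ω ∈ E δ ∨ ¬ (q ∈ z2QuadConfig univ δ ω ↔ q ∈ S') :=
    fun s hs => exists_quad_event_of_piece hcont (hpieces s hs) hη0
  haveI : Nonempty (Quad (univ : Set ℂ)) := ⟨Quad.unitSquare⟩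
  choose! q E δ₁ hδ₁ hEle hcase using key
  obtain ⟨δ₂, hδ₂, hδ₂le⟩ := exists_pos_le_of_finite h𝔉 hδ₁
  -- the finite family of quads and the coupling, at `ε / 2`
  set F : Finset (Quad (univ : Set ℂ)) := h𝔉.toFinset.image q with hFdef
  have hε2 : 0 < ε / 2 := by positivity
  obtain ⟨δF, hδF, hcoup⟩ := hF (ε / 2) hε2 F
  refine ⟨min δF (δ₂ / 2), lt_min hδF (by positivity), fun α hα δ hδ hδle => ?_⟩
  have hα' : α ∈ Set.Ioo (ε / 2) (Real.pi - ε / 2) := ⟨by linarith [hα.1], by linarith [hα.2]⟩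
  obtain ⟨P, hP1, hP2, hPF⟩ := hcoup α hα' δ hδ (hδle.trans (min_le_left _ _))
  refine ⟨P, hP1, hP2, ?_⟩
  have hδ₁lt : ∀ s ∈ 𝔉, δ < δ₁ s := fun s hs =>
    (hδle.trans (min_le_right _ _)).trans_lt ((half_lt_self hδ₂).trans_le (hδ₂le s hs))
  -- the inclusion of events
  have hincl : {p : BondConfig (Site 2) × BondConfig (Site 2) |
      (z2QuadConfig univ δ p.1, QuadConfig.rotate α (z2QuadConfig univ δ p.2)) ∉ N} ⊆
      (⋃ s ∈ h𝔉.toFinset, Prod.fst ⁻¹' E s δ) ∪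
        {p | ∃ Q ∈ F, ¬ (Q ∈ z2QuadConfig univ δ p.1 ↔
          Q ∈ QuadConfig.rotate α (z2QuadConfig univ δ p.2))} := by
    rintro ⟨ω, ω'⟩ hp
    obtain ⟨s, hs, hS, hS'⟩ := hdetect _ _ hp
    rcases hcase s hs δ ω _ hS hS' with hEω | hdis
    · exact Or.inl (mem_iUnion₂.2 ⟨s, h𝔉.mem_toFinset.2 hs, hEω⟩)
    · exact Or.inr ⟨q s, Finset.mem_image_of_mem q (h𝔉.mem_toFinset.2 hs), hdis⟩
  -- measure bounds
  have hsum : P (⋃ s ∈ h𝔉.toFinset, Prod.fst ⁻¹' E s δ) ≤ ENNReal.ofReal (ε / 2) := by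
    calc P (⋃ s ∈ h𝔉.toFinset, Prod.fst ⁻¹' E s δ)
        ≤ ∑ s ∈ h𝔉.toFinset, P (Prod.fst ⁻¹' E s δ) := measure_biUnion_finset_le _ _
      _ ≤ ∑ s ∈ h𝔉.toFinset, ENNReal.ofReal (ε / (2 * (n + 1))) :=
          Finset.sum_le_sum fun s hs => ?_
      _ = n * ENNReal.ofReal (ε / (2 * (n + 1))) := by rw [Finset.sum_const, nsmul_eq_mul]
      _ ≤ ENNReal.ofReal (ε / 2) := natCast_mul_ofReal_div_le n hε.le
    calc P (Prod.fst ⁻¹' E s δ) ≤ P.map Prod.fst (E s δ) :=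
          Measure.le_map_apply measurable_fst.aemeasurable _
      _ = bondPercolation (zdGraph 2) half (E s δ) := by rw [hP1]
      _ ≤ ENNReal.ofReal (ε / (2 * (n + 1))) :=
          hEle s (h𝔉.mem_toFinset.1 hs) δ hδ (hδ₁lt s (h𝔉.mem_toFinset.1 hs))
  calc P {p | (z2QuadConfig univ δ p.1, QuadConfig.rotate α (z2QuadConfig univ δ p.2)) ∉ N}
      ≤ P ((⋃ s ∈ h𝔉.toFinset, Prod.fst ⁻¹' E s δ) ∪
          {p | ∃ Q ∈ F, ¬ (Q ∈ z2QuadConfig univ δ p.1 ↔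
            Q ∈ QuadConfig.rotate α (z2QuadConfig univ δ p.2))}) := measure_mono hincl
    _ ≤ P (⋃ s ∈ h𝔉.toFinset, Prod.fst ⁻¹' E s δ) +
          P {p | ∃ Q ∈ F, ¬ (Q ∈ z2QuadConfig univ δ p.1 ↔
            Q ∈ QuadConfig.rotate α (z2QuadConfig univ δ p.2))} := measure_union_le _ _
    _ < ENNReal.ofReal (ε / 2) + ENNReal.ofReal (ε / 2) :=
        ENNReal.add_lt_add_of_le_of_lt (ne_top_of_le_ne_top ENNReal.ofReal_ne_top hsum) hsum hPF
    _ = ENNReal.ofReal ε := by rw [← ENNReal.ofReal_add hε2.le hε2.le, add_halves]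

/-- **Conversely, the fact and (5.1) give couplings agreeing on finitely many quads.**  For
`Q ∈ F` take `Q' < Q_m < Q < Q_p < Q''` from (5.1) at `Q` and the open neighbourhood of the diagonal
`N = ⋂_{Q ∈ F} {Q_p ∈ S → S' ∈ int ⊞_Q} ∩ {Q ∈ S' → S ∈ int ⊞_{Q_m}}`; under the coupling of the
fact at `(ε/2, N)`, a disagreement at `Q` on `N` forces `Q ∈ S_ω ∌ Q_p` or `Q_m ∈ S_ω ∌ Q`, hence
the (5.1)-event `{Q' raw-crossed ∧ Q'' not}` of the unrotated configuration.
[cite: DKKMO2020Rotational, Thm. 1.2 (d_SS part) and §7.1 p. 42] -/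
theorem finiteQuads_of_dkkmo_theorem_1_2_schrammSmirnov_of_continuity
    (h : dkkmo_theorem_1_2_schrammSmirnov)
    (hcont : ∀ (Q₀ : Quad (univ : Set ℂ)) (ε : ℝ≥0∞), 0 < ε →
      ∃ Q' Q'' : Quad (univ : Set ℂ), Quad.StrictlyDominated Q' Q₀ ∧ Quad.StrictlyDominated Q₀ Q'' ∧
        ∃ δ₀ : ℝ, 0 < δ₀ ∧ ∀ δ : ℝ, 0 < δ → δ < δ₀ →
          bondPercolation (zdGraph 2) half
            {ω | (∃ K, Q'.IsCrossing K ∧ K ⊆ openEdgeUnion δ ω) ∧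
              ¬ ∃ K, Q''.IsCrossing K ∧ K ⊆ openEdgeUnion δ ω} ≤ ε) :
    ∀ ε : ℝ, 0 < ε → ∀ F : Finset (Quad (univ : Set ℂ)),
      ∃ δ₀ : ℝ, 0 < δ₀ ∧ ∀ α ∈ Set.Ioo ε (Real.pi - ε), ∀ δ : ℝ, 0 < δ → δ ≤ δ₀ →
        ∃ P : Measure (BondConfig (Site 2) × BondConfig (Site 2)),
          P.map Prod.fst = bondPercolation (zdGraph 2) half ∧
          P.map Prod.snd = bondPercolation (zdGraph 2) half ∧
          P {p | ∃ Q ∈ F, ¬ (Q ∈ z2QuadConfig univ δ p.1 ↔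
            Q ∈ QuadConfig.rotate α (z2QuadConfig univ δ p.2))} < ENNReal.ofReal ε := by
  classical
  intro ε hε F
  set n : ℕ := F.card with hn
  have hηpos : 0 < ε / (2 * (n + 1)) := by positivity
  have hη0 : 0 < ENNReal.ofReal (ε / (2 * (n + 1))) := ENNReal.ofReal_pos.2 hηpos
  -- per quad: the data of (5.1) and intermediate quads `Q' < Qm < Q < Qp < Q''`
  have key : ∀ Q : Quad (univ : Set ℂ), ∃ (Qm Qp Q' Q'' : Quad (univ : Set ℂ)) (δ₁ : ℝ),
      Quad.StrictlyDominated Q' Qm ∧ Quad.StrictlyDominated Qm Q ∧ Quad.StrictlyDominated Q Qp ∧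
      Quad.StrictlyDominated Qp Q'' ∧ 0 < δ₁ ∧ ∀ δ : ℝ, 0 < δ → δ < δ₁ →
        bondPercolation (zdGraph 2) half {ω | (∃ K, Q'.IsCrossing K ∧ K ⊆ openEdgeUnion δ ω) ∧
          ¬ ∃ K, Q''.IsCrossing K ∧ K ⊆ openEdgeUnion δ ω} ≤ ENNReal.ofReal (ε / (2 * (n + 1))) := by
    intro Q
    obtain ⟨Q', Q'', hQ'Q, hQQ'', δ₁, hδ₁, hE⟩ := hcont Q _ hη0
    obtain ⟨Qm, hQ'Qm, hQmQ⟩ := Quad.exists_strictlyDominated_between isOpen_univ hQ'Q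
    obtain ⟨Qp, hQQp, hQpQ''⟩ := Quad.exists_strictlyDominated_between isOpen_univ hQQ''
    exact ⟨Qm, Qp, Q', Q'', δ₁, hQ'Qm, hQmQ, hQQp, hQpQ'', hδ₁, hE⟩
  choose Qm Qp Q' Q'' δ₁ hQ'Qm hQmQ hQQp hQpQ'' hδ₁ hE using key
  -- the open neighbourhood of the diagonal
  set N : Set (QuadConfig (univ : Set ℂ) × QuadConfig (univ : Set ℂ)) :=
    ⋂ Q ∈ F, ({p | Qp Q ∈ p.1 → p.2 ∈ interior (QuadConfig.crossedEvent Q)} ∩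
      {p | Q ∈ p.2 → p.1 ∈ interior (QuadConfig.crossedEvent (Qm Q))}) with hNdef
  have hNopen : IsOpen N := by
    refine isOpen_biInter_finset fun Q _ => IsOpen.inter ?_ ?_
    · have : {p : QuadConfig (univ : Set ℂ) × QuadConfig (univ : Set ℂ) |
          Qp Q ∈ p.1 → p.2 ∈ interior (QuadConfig.crossedEvent Q)} =
          (QuadConfig.crossedEvent (Qp Q) ×ˢ (interior (QuadConfig.crossedEvent Q))ᶜ)ᶜ := by
        ext p
        simp only [mem_setOf_eq, mem_compl_iff, mem_prod, QuadConfig.mem_crossedEvent]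
        tauto
      rw [this]
      exact ((QuadConfig.isClosed_crossedEvent _).prod isOpen_interior.isClosed_compl).isOpen_compl
    · have : {p : QuadConfig (univ : Set ℂ) × QuadConfig (univ : Set ℂ) |
          Q ∈ p.2 → p.1 ∈ interior (QuadConfig.crossedEvent (Qm Q))} =
          ((interior (QuadConfig.crossedEvent (Qm Q)))ᶜ ×ˢ QuadConfig.crossedEvent Q)ᶜ := by
        ext p
        simp only [mem_setOf_eq, mem_compl_iff, mem_prod, QuadConfig.mem_crossedEvent]
        tauto
      rw [this]
      exact (isOpen_interior.isClosed_compl.prod (QuadConfig.isClosed_crossedEvent _)).isOpen_compl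
  have hNdiag : ∀ S, (S, S) ∈ N := fun S => mem_iInter₂.2 fun Q _ =>
    ⟨fun hS => QuadConfig.mem_interior_crossedEvent_of_mem (hQQp Q) hS,
      fun hS => QuadConfig.mem_interior_crossedEvent_of_mem (hQmQ Q) hS⟩
  -- a common mesh bound and the coupling of the fact at `ε / 2`
  obtain ⟨δ₂, hδ₂, hδ₂le⟩ := exists_pos_le_of_finite F.finite_toSet fun Q _ => hδ₁ Q
  have hε2 : 0 < ε / 2 := by positivity
  obtain ⟨δh, hδh, hcoup⟩ := h (ε / 2) hε2 N hNopen hNdiag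
  refine ⟨min δh (δ₂ / 2), lt_min hδh (by positivity), fun α hα δ hδ hδle => ?_⟩
  have hα' : α ∈ Set.Ioo (ε / 2) (Real.pi - ε / 2) := ⟨by linarith [hα.1], by linarith [hα.2]⟩
  obtain ⟨P, hP1, hP2, hPN⟩ := hcoup α hα' δ hδ (hδle.trans (min_le_left _ _))
  refine ⟨P, hP1, hP2, ?_⟩
  have hδ₁lt : ∀ Q ∈ F, δ < δ₁ Q := fun Q hQ =>
    (hδle.trans (min_le_right _ _)).trans_lt ((half_lt_self hδ₂).trans_le (hδ₂le Q hQ))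
  -- the (5.1)-events of the quads of `F` at mesh `δ`
  set E : Quad (univ : Set ℂ) → Set (BondConfig (Site 2)) := fun Q =>
    {ω | (∃ K, (Q' Q).IsCrossing K ∧ K ⊆ openEdgeUnion δ ω) ∧
      ¬ ∃ K, (Q'' Q).IsCrossing K ∧ K ⊆ openEdgeUnion δ ω} with hEdef
  -- the inclusion of events
  have hincl : {p : BondConfig (Site 2) × BondConfig (Site 2) | ∃ Q ∈ F,
      ¬ (Q ∈ z2QuadConfig univ δ p.1 ↔ Q ∈ QuadConfig.rotate α (z2QuadConfig univ δ p.2))} ⊆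
      {p | (z2QuadConfig univ δ p.1, QuadConfig.rotate α (z2QuadConfig univ δ p.2)) ∉ N} ∪
        ⋃ Q ∈ F, Prod.fst ⁻¹' E Q := by
    rintro ⟨ω, ω'⟩ ⟨Q, hQF, hdis⟩
    by_cases hpN : (z2QuadConfig univ δ ω, QuadConfig.rotate α (z2QuadConfig univ δ ω')) ∈ N
    · refine Or.inr (mem_iUnion₂.2 ⟨Q, hQF, ?_⟩)
      have hQN := mem_iInter₂.1 hpN Q hQF
      show ω ∈ E Q
      by_cases hQS : Q ∈ z2QuadConfig univ δ ω
      · -- `Q ∈ S_ω`, so `Q ∉ e^{iα}·S_{ω'}`, and on `N`, `Qp ∉ S_ω`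
        have hQS' : Q ∉ QuadConfig.rotate α (z2QuadConfig univ δ ω') :=
          fun h' => hdis ⟨fun _ => h', fun _ => hQS⟩
        have hQp : Qp Q ∉ z2QuadConfig univ δ ω := fun h' =>
          hQS' (show QuadConfig.rotate α (z2QuadConfig univ δ ω') ∈ QuadConfig.crossedEvent Q from
            interior_subset (hQN.1 h'))
        exact ⟨exists_isCrossing_of_mem_z2QuadConfig ((hQ'Qm Q).trans (hQmQ Q)) hQS,
          not_exists_isCrossing_of_not_mem_z2QuadConfig (hQpQ'' Q) hQp⟩
      · -- `Q ∉ S_ω`, so `Q ∈ e^{iα}·S_{ω'}`, and on `N`, `Qm ∈ S_ω`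
        have hQS' : Q ∈ QuadConfig.rotate α (z2QuadConfig univ δ ω') := by
          by_contra h'
          exact hdis ⟨fun h₁ => absurd h₁ hQS, fun h₂ => absurd h₂ h'⟩
        have hQm : z2QuadConfig univ δ ω ∈ QuadConfig.crossedEvent (Qm Q) :=
          interior_subset (hQN.2 hQS')
        exact ⟨exists_isCrossing_of_mem_z2QuadConfig (hQ'Qm Q) hQm,
          not_exists_isCrossing_of_not_mem_z2QuadConfig ((hQQp Q).trans (hQpQ'' Q)) hQS⟩
    · exact Or.inl hpN
  -- measure bounds
  have hsum : P (⋃ Q ∈ F, Prod.fst ⁻¹' E Q) ≤ ENNReal.ofReal (ε / 2) := by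
    calc P (⋃ Q ∈ F, Prod.fst ⁻¹' E Q)
        ≤ ∑ Q ∈ F, P (Prod.fst ⁻¹' E Q) := measure_biUnion_finset_le _ _
      _ ≤ ∑ Q ∈ F, ENNReal.ofReal (ε / (2 * (n + 1))) := Finset.sum_le_sum fun Q hQ => ?_
      _ = n * ENNReal.ofReal (ε / (2 * (n + 1))) := by rw [Finset.sum_const, nsmul_eq_mul]
      _ ≤ ENNReal.ofReal (ε / 2) := natCast_mul_ofReal_div_le n hε.le
    calc P (Prod.fst ⁻¹' E Q) ≤ P.map Prod.fst (E Q) :=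
          Measure.le_map_apply measurable_fst.aemeasurable _
      _ = bondPercolation (zdGraph 2) half (E Q) := by rw [hP1]
      _ ≤ ENNReal.ofReal (ε / (2 * (n + 1))) := hE Q δ hδ (hδ₁lt Q hQ)
  calc P {p | ∃ Q ∈ F, ¬ (Q ∈ z2QuadConfig univ δ p.1 ↔
          Q ∈ QuadConfig.rotate α (z2QuadConfig univ δ p.2))}
      ≤ P ({p | (z2QuadConfig univ δ p.1, QuadConfig.rotate α (z2QuadConfig univ δ p.2)) ∉ N} ∪
          ⋃ Q ∈ F, Prod.fst ⁻¹' E Q) := measure_mono hincl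
    _ ≤ P {p | (z2QuadConfig univ δ p.1, QuadConfig.rotate α (z2QuadConfig univ δ p.2)) ∉ N} +
          P (⋃ Q ∈ F, Prod.fst ⁻¹' E Q) := measure_union_le _ _
    _ < ENNReal.ofReal (ε / 2) + ENNReal.ofReal (ε / 2) :=
        ENNReal.add_lt_add_of_lt_of_le (ne_top_of_le_ne_top ENNReal.ofReal_ne_top hsum) hPN hsum
    _ = ENNReal.ofReal ε := by rw [← ENNReal.ofReal_add hε2.le hε2.le, add_halves]

/-! ### Packaging: the equivalence, and the versions from the named fact `SchrammSmirnov2011_lemma_5_1` -/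

/-- **Granted Schramm–Smirnov's (5.1), DKKMO's `d_SS` statement is equivalent to the statement
about finitely many quads.** [cite: DKKMO2020Rotational, Thm. 1.2 (d_SS part) and §7.1 p. 42] -/
theorem dkkmo_theorem_1_2_schrammSmirnov_iff_finiteQuads_of_continuity
    (hcont : ∀ (Q₀ : Quad (univ : Set ℂ)) (ε : ℝ≥0∞), 0 < ε →
      ∃ Q' Q'' : Quad (univ : Set ℂ), Quad.StrictlyDominated Q' Q₀ ∧ Quad.StrictlyDominated Q₀ Q'' ∧
        ∃ δ₀ : ℝ, 0 < δ₀ ∧ ∀ δ : ℝ, 0 < δ → δ < δ₀ →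
          bondPercolation (zdGraph 2) half
            {ω | (∃ K, Q'.IsCrossing K ∧ K ⊆ openEdgeUnion δ ω) ∧
              ¬ ∃ K, Q''.IsCrossing K ∧ K ⊆ openEdgeUnion δ ω} ≤ ε) :
    dkkmo_theorem_1_2_schrammSmirnov ↔
      ∀ ε : ℝ, 0 < ε → ∀ F : Finset (Quad (univ : Set ℂ)),
        ∃ δ₀ : ℝ, 0 < δ₀ ∧ ∀ α ∈ Set.Ioo ε (Real.pi - ε), ∀ δ : ℝ, 0 < δ → δ ≤ δ₀ →
          ∃ P : Measure (BondConfig (Site 2) × BondConfig (Site 2)),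
            P.map Prod.fst = bondPercolation (zdGraph 2) half ∧
            P.map Prod.snd = bondPercolation (zdGraph 2) half ∧
            P {p | ∃ Q ∈ F, ¬ (Q ∈ z2QuadConfig univ δ p.1 ↔
              Q ∈ QuadConfig.rotate α (z2QuadConfig univ δ p.2))} < ENNReal.ofReal ε :=
  ⟨fun h => finiteQuads_of_dkkmo_theorem_1_2_schrammSmirnov_of_continuity h hcont,
    fun hF => dkkmo_theorem_1_2_schrammSmirnov_of_finiteQuads_of_continuity hcont hF⟩

/-- **DKKMO Thm. 1.2 (`d_SS` half, `q = 1`, plane) from couplings agreeing on finitely many quads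
and the named fact `SchrammSmirnov2011_lemma_5_1`** (which supplies (5.1) at `D = univ`,
`Quad.continuity_of_lemma_5_1`). [cite: DKKMO2020Rotational, Thm. 1.2 (d_SS part) and §7.1 p. 42] -/
theorem dkkmo_theorem_1_2_schrammSmirnov_of_finiteQuads_of_lemma_5_1
    (h51 : SchrammSmirnov2011_lemma_5_1)
    (hF : ∀ ε : ℝ, 0 < ε → ∀ F : Finset (Quad (univ : Set ℂ)),
      ∃ δ₀ : ℝ, 0 < δ₀ ∧ ∀ α ∈ Set.Ioo ε (Real.pi - ε), ∀ δ : ℝ, 0 < δ → δ ≤ δ₀ →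
        ∃ P : Measure (BondConfig (Site 2) × BondConfig (Site 2)),
          P.map Prod.fst = bondPercolation (zdGraph 2) half ∧
          P.map Prod.snd = bondPercolation (zdGraph 2) half ∧
          P {p | ∃ Q ∈ F, ¬ (Q ∈ z2QuadConfig univ δ p.1 ↔
            Q ∈ QuadConfig.rotate α (z2QuadConfig univ δ p.2))} < ENNReal.ofReal ε) :
    dkkmo_theorem_1_2_schrammSmirnov :=
  dkkmo_theorem_1_2_schrammSmirnov_of_finiteQuads_of_continuity
    (fun Q₀ ε hε => Quad.continuity_of_lemma_5_1 h51 Q₀ ε hε) hF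

/-- **Granted the named fact `SchrammSmirnov2011_lemma_5_1`, DKKMO's `d_SS` statement
`dkkmo_theorem_1_2_schrammSmirnov` is equivalent to: for every finite family of quads and
`ε > 0`, for `α ∈ (ε, π - ε)` and small meshes, some coupling of two critical bond percolations on
`ℤ²` makes all the crossing indicators of the family in `S_{ω_δ}` and `e^{iα}·S_{ω'_δ}` agree
outside an event of probability `< ε`.** [cite: DKKMO2020Rotational, Thm. 1.2 (d_SS part) and §7.1 p. 42] -/
theorem dkkmo_theorem_1_2_schrammSmirnov_iff_finiteQuads_of_lemma_5_1
    (h51 : SchrammSmirnov2011_lemma_5_1) :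
    dkkmo_theorem_1_2_schrammSmirnov ↔
      ∀ ε : ℝ, 0 < ε → ∀ F : Finset (Quad (univ : Set ℂ)),
        ∃ δ₀ : ℝ, 0 < δ₀ ∧ ∀ α ∈ Set.Ioo ε (Real.pi - ε), ∀ δ : ℝ, 0 < δ → δ ≤ δ₀ →
          ∃ P : Measure (BondConfig (Site 2) × BondConfig (Site 2)),
            P.map Prod.fst = bondPercolation (zdGraph 2) half ∧
            P.map Prod.snd = bondPercolation (zdGraph 2) half ∧
            P {p | ∃ Q ∈ F, ¬ (Q ∈ z2QuadConfig univ δ p.1 ↔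
              Q ∈ QuadConfig.rotate α (z2QuadConfig univ δ p.2))} < ENNReal.ofReal ε :=
  dkkmo_theorem_1_2_schrammSmirnov_iff_finiteQuads_of_continuity
    fun Q₀ ε hε => Quad.continuity_of_lemma_5_1 h51 Q₀ ε hε

end Literature.Probability.Percolation
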